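import Mathlib
import Summits.Ventures.HodgeRepro.Tier4.Line4.UnitTorsionLocal
import Summits.Ventures.HodgeRepro.Tier4.Line4.CentreFinDomain
import Summits.Ventures.HodgeRepro.Tier4.Line4.LevelVolume
import Summits.Ventures.HodgeRepro.Tier4.Line4.LevelIntersectionGA
import Summits.Ventures.HodgeRepro.Tier4.Line4.LevelPrime
import Summits.Ventures.HodgeRepro.Tier4.Line4.TransporterLocal
import Summits.Ventures.HodgeRepro.Tier4.Line4.SuppMeasureFinite
import Summits.Ventures.HodgeRepro.Tier4.Line4.OrbitProper

/-!
# Tier4/Line4/UnitInstance — C-L4-UNIT-TORSION (`Z(k) ∩ K_T(p^{n₁}) = 1` for `p^{n₁} > 2`) and the (S-UNIT) instance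
`hv` of the (7b) glue at `γ₀`

Blind re-derivation cell `pub-hodge-repro`, Tier 4 «prove the step» (README §9–§10), seat t4-L2-p2 (gen 5; plan-4 g6's cut
S15670 «C-L4-UNIT-TORSION + the (S-UNIT) INSTANCE», TAKEN S15678).  Tree path
`lean/Summits/Ventures/HodgeRepro/Tier4/Line4/UnitInstance.lean`.  Imports the LOCAL half `Line4/UnitTorsionLocal`
(the torsion-freeness of `1 + p^{n₁} M_4(𝓞_v)`, Mathlib-only), `Line4/CentreFinDomain` (`centreFin`, `finTfHom`,
`CentreFinFinite`, `discreteTopology_centreFin_of_centreFinFinite`, `exists_adMat_of_mem_rationalPoints`,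
`eq_one_of_mem_rationalCentreT_of_finTfHom_eq_one`, `ZfIn`), `Line4/LevelVolume` (`levelTf`, `isCompact_levelTf`,
`one_mem_levelTf`), `Line4/LevelIntersectionGA` (`levelK_pow_antitone'`, `adComponentFin_eq`, `adComponentFin_one_apply`),
`Line4/LevelPrime` (`natSize_lt_one_iff`), L2-p3's `Line4/TransporterLocal` (`finiteComponent_ofFinPart`,
`nearMat_finiteComponent_of_mem_levelK`), `Line4/SuppMeasureFinite` (`suppMeasure_toReal_pos`, `suppMeasure_ne_top`)
and `Line4/OrbitProper` (`hasProperFinOrbit_of_isLinRegular`).  Mathlib-level; no literature.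

WHAT IS PROVED.
* `exists_natSize_lt_one_of_prime`: every rational prime `p` lies below some finite place `v` of `k` (`|p|_v < 1`).
* **`centreFin_inter_levelTf_pow_eq_one`** (C-L4-UNIT-TORSION): under the CM input `CentreFinFinite W` (`Z(k)` meets a
  compact open subgroup of `T_f` in a finite set — a THEOREM on `ofLinesRow` by `CentreFinSeesaw`), for a prime `p` and
  `n₁` with `p^{n₁} > 2`, `centreFin W ∩ levelTf W (p^{n₁}) = {1}`: the intersection is a subgroup of `T_f` that is
  discrete (inside `centreFin`) and compact (closed, inside the compact trace `levelTf`), hence FINITE, so every element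
  is torsion; a torsion rational matrix `≡ 1 (mod p^{n₁})` at a place `v ∣ p` is `1` by the local theorem, and a
  rational matrix is determined by its `v`-component.  Corollary `eq_of_mem_levelTf_pow_of_mul_mem_centreFin`: two
  `Z(k)`-equivalent points of `levelTf (p^{n₁})` coincide — the trace `levelTf (p^{n₁})` meets every `Z(k)`-orbit at most
  once, which is what makes the choice `levelTf (p^{n₁}) ⊆ DZ_f` consistent with `IsFundamentalDomain (centreFin W) DZf νf`.
* `levelTf_pow_antitone`: `levelTf (p^m) ⊆ levelTf (p^n)` for `n ≤ m` (the torus twin of `levelK_pow_antitone'`).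
* **`suppMeasure_toReal_pos_of_isLinRegular`** — the (S-UNIT) instance: the `hv` binder of x2's glue
  `exists_levelFamily_fibreDominated_of_displays_main` at `γ₀`, verbatim
  (`∀ N, 0 < (suppMeasure W νf νf' γ₀ DZf (p ^ (N + n₁)) γ₀).toReal`), from `hDZ : levelTf (p^{n₁}) ⊆ DZf` through
  `levelTf_pow_antitone`, finiteness from `suppMeasure_ne_top` under ZDOMAIN-EX (iv) (`hDZc`, DISPLAYED as a hypothesis,
  never assumed) and PROPER from `hasProperFinOrbit_of_isLinRegular` (`hdet`, `hg`, `hreg`).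

Nothing here says anything about the status of the Hodge conjecture for CM abelian varieties, which is NOT proved
(HC_CM is NOT proved by anyone in this repository).
-/

set_option autoImplicit false

noncomputable section

namespace Summit.Ventures.HodgeRepro.Tier4.Line4

open Summit.Ventures.HodgeRepro.Tier4 Summit.Ventures.HodgeRepro.Tier4.Common
  Summit.Ventures.HodgeRepro.Tier4.Line1 MeasureTheory NumberField IsDedekindDomain
open scoped NumberField Topology Pointwise

/-! ## A place above every rational prime -/

section Place

variable {k : Type} [Field k] [NumberField k]

/-- The coercion `k → k_v` sends a natural number to the natural number. -/
theorem coe_natCast_adicCompletion (v : HeightOneSpectrum (𝓞 k)) (N : ℕ) :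
    ((N : k) : v.adicCompletion k) = (N : v.adicCompletion k) :=
  map_natCast (algebraMap k (v.adicCompletion k)) N

/-- `natSize k v N` is the valuation of the natural number `N` read in `k_v`. -/
theorem natSize_eq_valued_natCast (v : HeightOneSpectrum (𝓞 k)) (N : ℕ) :
    natSize k v N = Valued.v (N : v.adicCompletion k) := by
  unfold natSize
  rw [coe_natCast_adicCompletion]

/-- **Every rational prime lies below a finite place of `k`**: `(p)` is a proper ideal of `𝓞 k` (its absolute norm is
`p^{[k:ℚ]} ≠ 1`), a maximal ideal above it is a height-one prime `v`, and `|p|_v < 1` there. -/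
theorem exists_natSize_lt_one_of_prime {p : ℕ} (hp : p.Prime) :
    ∃ v : HeightOneSpectrum (𝓞 k), natSize k v p < 1 := by
  have hne : Ideal.span {(p : 𝓞 k)} ≠ ⊤ := by
    intro htop
    have h1 := Ideal.absNorm_eq_one_iff.2 htop
    rw [Ideal.absNorm_span_singleton, Algebra.norm_natCast] at h1
    have h2 : p ^ Module.finrank ℤ (𝓞 k) = 1 := by
      have := h1
      rw [Int.natAbs_pow] at this
      simpa using this
    have hpos : 0 < Module.finrank ℤ (𝓞 k) := Module.finrank_pos
    rcases Nat.pow_eq_one.1 h2 with h | h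
    · exact hp.one_lt.ne' h
    · omega
  obtain ⟨M, hM, hle⟩ := Ideal.exists_le_maximal _ hne
  have hbot : M ≠ ⊥ := Ring.ne_bot_of_isMaximal_of_not_isField hM (NumberField.RingOfIntegers.not_isField k)
  refine ⟨⟨M, hM.isPrime, hbot⟩, ?_⟩
  rw [natSize_lt_one_iff]
  exact hle (Ideal.mem_span_singleton_self _)

end Place

/-! ## The local matrix of a rational element, and the congruence at `v` of a level element -/

section Local

variable {k : Type} [Field k] [NumberField k] (W : PlaneData k)

/-- The `v`-component matrix of an element whose adelic matrix is the rational matrix `A` is `A` read in `k_v`. -/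
theorem finiteComponent_val_eq_map_of_eq_adMat (v : HeightOneSpectrum (𝓞 k)) {g : GA W}
    {A : Matrix (Fin 4) (Fin 4) k} (hg : GA.mat W g = adMat k A) :
    ((GA.finiteComponent W v g : GL (Fin 4) (v.adicCompletion k)) : Matrix (Fin 4) (Fin 4) (v.adicCompletion k)) =
      A.map (algebraMap k (v.adicCompletion k)) := by
  refine Matrix.ext fun i j => ?_
  rw [GA.finiteComponent_apply, hg, Matrix.map_apply]
  exact adComponentFin_algebraMap k v (A i j)

/-- **The congruence at `v` of a level element**: for `g ∈ K(N)` the `v`-component matrix `g_v` has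
`matV (g_v − 1) ≤ |N|_v` (every entry of `g − 1` lies in `N·𝓞_v`; L2-p3's `nearMat_finiteComponent_of_mem_levelK`
entrywise). -/
theorem matV_finiteComponent_sub_one_le_of_mem_levelK (v : HeightOneSpectrum (𝓞 k)) {g : GA W} {N : ℕ}
    (hg : g ∈ levelK W N) :
    matV (((GA.finiteComponent W v g : GL (Fin 4) (v.adicCompletion k)) :
      Matrix (Fin 4) (Fin 4) (v.adicCompletion k)) - 1) ≤ natSize k v N :=
  matV_le_iff.2 fun i j => by
    rw [Matrix.sub_apply]
    exact nearMat_finiteComponent_of_mem_levelK W v hg i j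

end Local

/-! ## C-L4-UNIT-TORSION: `Z(k) ∩ K_T(p^{n₁}) = 1` -/

section Torsion

variable {k : Type} [Field k] [NumberField k] (W : PlaneData k)

/-- The trace of `K(N)` on `T_f`, as a subgroup of `T_f` (its carrier is `levelTf W N`). -/
def levelTfSub (N : ℕ) : Subgroup (torusFin W) :=
  (levelK W N).comap ((torusT W).subtype.comp (torusFin W).subtype)

/-- The carrier of `levelTfSub` is `levelTf`. -/
theorem coe_levelTfSub (N : ℕ) : (levelTfSub W N : Set (torusFin W)) = levelTf W N := rfl

/-- Membership in `levelTfSub` is membership in `levelTf`. -/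
theorem mem_levelTfSub {N : ℕ} {b : torusFin W} : b ∈ levelTfSub W N ↔ b ∈ levelTf W N := Iff.rfl

/-- **A torsion element of the image of `Z(k)` that lies in `K_T(p^{n₁})` is `1`** (`p` prime, `p^{n₁} > 2`): at a
place `v ∣ p` its `v`-component matrix is `≡ 1 (mod p^{n₁})` and of finite order, hence `1` by the local theorem
`eq_one_of_pow_eq_one_of_matV_sub_one_le`; a rational matrix with trivial `v`-component is `1`. -/
theorem eq_one_of_mem_centreFin_of_mem_levelTf_pow_of_pow_eq_one {p n₁ : ℕ} (hp : p.Prime) (hpn : 2 < p ^ n₁)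
    {z : torusFin W} (hz : z ∈ centreFin W) (hlev : z ∈ levelTf W (p ^ n₁)) {m : ℕ} (hm : m ≠ 0)
    (hzm : z ^ m = 1) : z = 1 := by
  obtain ⟨ζ, hζ, rfl⟩ := hz
  obtain ⟨v, hv⟩ := exists_natSize_lt_one_of_prime (k := k) hp
  obtain ⟨A, hA⟩ := exists_adMat_of_mem_rationalPoints W (rationalCentreT.mem_rationalPoints W hζ)
  -- `ζ ^ m = 1` in `T(𝔸)`
  have hζm : ζ ^ m = 1 :=
    eq_one_of_mem_rationalCentreT_of_finTfHom_eq_one W (pow_mem hζ m) (by rw [map_pow, hzm])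
  have hζm' : (ζ : GA W) ^ m = 1 := by
    rw [← Subgroup.coe_pow, hζm, OneMemClass.coe_one]
  -- the finite part of `ζ` lies in `K(p^{n₁})`
  have hlev' : GA.ofFinPart W (ζ : GA W) ∈ levelK W (p ^ n₁) := by
    have h : ((finTfHom W ζ : torusT W) : GA W) ∈ levelK W (p ^ n₁) := hlev
    rwa [coe_coe_finTfHom] at h
  -- the local matrix `A_v`
  have hpv : Valued.v (p : v.adicCompletion k) < 1 := by
    rw [← natSize_eq_valued_natCast]; exact hv
  have hcong : matV (A.map (algebraMap k (v.adicCompletion k)) - 1) ≤ Valued.v (p : v.adicCompletion k) ^ n₁ := by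
    have h := matV_finiteComponent_sub_one_le_of_mem_levelK W v hlev'
    rwa [finiteComponent_ofFinPart W v, finiteComponent_val_eq_map_of_eq_adMat W v hA, natSize_pow,
      natSize_eq_valued_natCast] at h
  have hpow : A.map (algebraMap k (v.adicCompletion k)) ^ m = 1 := by
    rw [← finiteComponent_val_eq_map_of_eq_adMat W v hA, ← Units.val_pow_eq_pow_val, ← map_pow, hζm', map_one,
      Units.val_one]
  have hAv : A.map (algebraMap k (v.adicCompletion k)) = 1 :=
    eq_one_of_pow_eq_one_of_matV_sub_one_le hp hpv hpn hcong hm hpow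
  -- hence `A = 1`
  have hA1 : A = 1 := by
    ext i j
    have h := congrFun (congrFun hAv i) j
    rw [Matrix.map_apply] at h
    apply (algebraMap k (v.adicCompletion k)).injective
    rw [h, Matrix.one_apply, Matrix.one_apply]
    split_ifs <;> simp
  -- hence `ζ = 1` and `z = 1`
  have hζ1 : ζ = 1 := by
    apply Subtype.ext
    apply Subtype.ext
    apply Units.ext
    show GA.mat W (ζ : GA W) = 1
    rw [hA, hA1, adMat_one]
  rw [hζ1, map_one]

/-- Under the CM input, `Z(k) ∩ K_T(N)` is FINITE (`N ≠ 0`): a discrete closed subgroup meets a compact set in a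
finite set. -/
theorem finite_centreFin_inter_levelTf (hZ : CentreFinFinite W) {N : ℕ} (hN : N ≠ 0) :
    ((centreFin W : Set (torusFin W)) ∩ levelTf W N).Finite := by
  haveI : T2Space (torusFin W) := t2Space_torusFin W
  haveI hdisc : DiscreteTopology (centreFin W) := discreteTopology_centreFin_of_centreFinFinite W hZ
  have hclosed : IsClosed (centreFin W : Set (torusFin W)) := Subgroup.isClosed_of_discrete
  have hcpt : IsCompact ((centreFin W : Set (torusFin W)) ∩ levelTf W N) :=
    (isCompact_levelTf W hN).inter_left hclosed
  refine hcpt.finite ?_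
  rw [isDiscrete_iff_discreteTopology]
  exact DiscreteTopology.of_subset hdisc Set.inter_subset_left

/-- **C-L4-UNIT-TORSION**: under the CM input `CentreFinFinite W`, for a prime `p` and `n₁` with `p^{n₁} > 2`,
`centreFin W ∩ levelTf W (p^{n₁}) = {1}` — the global norm-one units in the principal congruence subgroup of level
`p^{n₁}` are trivial (they are torsion, and `1 + p^{n₁} M_4(𝓞_v)` is torsion-free). -/
theorem centreFin_inter_levelTf_pow_eq_one (hZ : CentreFinFinite W) {p n₁ : ℕ} (hp : p.Prime)
    (hpn : 2 < p ^ n₁) : (centreFin W : Set (torusFin W)) ∩ levelTf W (p ^ n₁) = {1} := by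
  have hN : p ^ n₁ ≠ 0 := pow_ne_zero _ hp.ne_zero
  have hfin := finite_centreFin_inter_levelTf W hZ hN
  ext z
  simp only [Set.mem_inter_iff, SetLike.mem_coe, Set.mem_singleton_iff]
  constructor
  · rintro ⟨hz, hlev⟩
    -- the powers of `z` stay in the finite set `Z(k) ∩ K_T(p^{n₁})`: pigeonhole gives `z ^ a = z ^ b`, `a < b`
    have hmaps : ∀ n : ℕ, z ^ n ∈ (centreFin W : Set (torusFin W)) ∩ levelTf W (p ^ n₁) := fun n =>
      ⟨pow_mem hz n, (levelTfSub W (p ^ n₁)).pow_mem hlev n⟩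
    obtain ⟨a, b, hab, heq⟩ := Set.Finite.exists_lt_map_eq_of_forall_mem hmaps hfin
    have hzm' : z ^ (b - a) = 1 := by
      have h : z ^ b = z ^ a * z ^ (b - a) := by rw [← pow_add, Nat.add_sub_cancel' hab.le]
      rw [h] at heq
      exact mul_eq_left.1 heq.symm
    exact eq_one_of_mem_centreFin_of_mem_levelTf_pow_of_pow_eq_one W hp hpn hz hlev (by omega) hzm'
  · rintro rfl
    exact ⟨one_mem _, one_mem_levelTf W _⟩

/-- **The trace `levelTf (p^{n₁})` meets every `Z(k)`-orbit at most once**: two points of it that differ by an element of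
`centreFin W` coincide (`p` prime, `p^{n₁} > 2`, CM input) — the consistency of `levelTf (p^{n₁}) ⊆ DZ_f` with
`IsFundamentalDomain (centreFin W) DZf νf`. -/
theorem eq_of_mem_levelTf_pow_of_mul_mem_centreFin (hZ : CentreFinFinite W) {p n₁ : ℕ} (hp : p.Prime)
    (hpn : 2 < p ^ n₁) {b b' : torusFin W} (hb : b ∈ levelTf W (p ^ n₁)) (hb' : b' ∈ levelTf W (p ^ n₁))
    {z : torusFin W} (hz : z ∈ centreFin W) (hzb : z * b = b') : b = b' := by
  have hzlev : z ∈ levelTfSub W (p ^ n₁) := by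
    have h : z = b' * b⁻¹ := by rw [← hzb, mul_inv_cancel_right]
    rw [h]
    exact mul_mem hb' (inv_mem hb)
  have hz1 : z ∈ ({1} : Set (torusFin W)) := by
    rw [← centreFin_inter_levelTf_pow_eq_one W hZ hp hpn]
    exact ⟨hz, hzlev⟩
  rw [Set.mem_singleton_iff] at hz1
  rw [← hzb, hz1, one_mul]

end Torsion

/-! ## The (S-UNIT) instance at `γ₀` -/

section Unit

variable {k : Type} [Field k] [NumberField k] (W : PlaneData k)

/-- **Antitone along `p`-powers**: `levelTf (p^m) ⊆ levelTf (p^n)` for `n ≤ m` (the torus twin of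
`levelK_pow_antitone'`). -/
theorem levelTf_pow_antitone (p : ℕ) {n m : ℕ} (h : n ≤ m) : levelTf W (p ^ m) ⊆ levelTf W (p ^ n) :=
  fun _ hb => levelK_pow_antitone' W p h hb

/-- **The (S-UNIT) instance**: the `hv` binder of the (7b) glue at `γ₀` — `0 < (suppMeasure N γ₀).toReal` along
`N = p^{N'+n₁}` for every `N'` — from the choice `levelTf (p^{n₁}) ⊆ DZ_f` (propagated to every deeper level by
`levelTf_pow_antitone`), finiteness under ZDOMAIN-EX (iv) (`hDZc`) and PROPER at `γ₀` (`hasProperFinOrbit_of_isLinRegular`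
from the LIN form), through `suppMeasure_toReal_pos` / `suppMeasure_ne_top`. -/
theorem suppMeasure_toReal_pos_of_isLinRegular [MeasurableSpace (GA W)] (νf : Measure (torusFin W))
    [νf.IsHaarMeasure] (νf' : Measure (torusFin' W)) [νf'.IsHaarMeasure] (γ₀ : rationalPoints W)
    (DZf : Set (torusFin W))
    (hDZc : ∀ C : Set (torusFin W), IsCompact C → IsCompact (closure (DZf ∩ (C * (ZfIn W : Set (torusFin W))))))
    (hdet : W.B.det ≠ 0) (hg : Line1.IsGenuineRow W) (hreg : Line1.IsLinRegular W γ₀) (p n₁ : ℕ) (hp : p ≠ 0)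
    (hDZ : levelTf W (p ^ n₁) ⊆ DZf) :
    ∀ N : ℕ, 0 < (suppMeasure W νf νf' (γ₀ : GA W) DZf (p ^ (N + n₁)) (γ₀ : GA W)).toReal := fun N =>
  suppMeasure_toReal_pos W νf νf' (γ₀ : GA W) DZf (pow_ne_zero _ hp)
    ((levelTf_pow_antitone W p (Nat.le_add_left n₁ N)).trans hDZ)
    (suppMeasure_ne_top W νf νf' (γ₀ : GA W) DZf hDZc (pow_ne_zero _ hp)
      (hasProperFinOrbit_of_isLinRegular W hdet hg γ₀ hreg))

end Unit

end Summit.Ventures.HodgeRepro.Tier4.Line4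

end
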